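import Summits.ResolutionOfSingularities.ResolutionOfSingularities.Theorems.WildDescent5
import HarnessLib

/-!
# WildDescent (6/13) — β-descent in a linear frame; §6 FreeChart (L3b), part 1: `free_step` (Θ-identity + nearness)

Verbatim slice of the farm-checked monolith `WildDescent.lean` of cell `decomp-res`, seat `decomp-res-lens-5`, g36
(sha256 4ec0fa6f4f9efba7…); one namespace `Summit.ResolutionOfSingularities.ResolutionOfSingularities.Theorems.WildDescent` across the
slices, imports chained (laws L1–L7 and the mechanism: module docstring of slice 1; main theorems: slice 13/13).
-/

open MvPolynomial Finset
open scoped BigOperators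
open Literature.AlgebraicGeometry.Resolution
open Literature.AlgebraicGeometry.Resolution.Hauser2010
open Literature.AlgebraicGeometry.Resolution.PointBlowup
open Literature.AlgebraicGeometry.Resolution.HauserPerlega2024

namespace Summit.ResolutionOfSingularities.ResolutionOfSingularities.Theorems.WildDescent

/-! ## §6 THE FREE-CHART MOVE (L3b: the Θ-identity, nearness `1 + a_l β = 0`, the expansion, and the point laws
`Δ' ⊆ ↑T(Δ)`, `min T(Δ) ∈ Δ'`) -/

section FreeChart

variable {K : Type} [Field K]

/-- Images of monomials of degree `≥ n` under a substitution `y_i ↦ y_j · A_i` are divisible by `y_j^n`. [folklore] -/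
theorem aeval_mem_span_pow {σ : Type*} {j : σ} {Θ : σ → MvPolynomial σ K} (hΘ : ∀ i, (X j : MvPolynomial σ K) ∣ Θ i)
    {n : ℕ} {P : MvPolynomial σ K} (hP : ∀ d ∈ P.support, n ≤ d.degree) :
    aeval Θ P ∈ Ideal.span {(X j ^ n : MvPolynomial σ K)} := by
  classical
  rw [P.as_sum, map_sum]
  refine Ideal.sum_mem _ fun d hd => Ideal.mem_span_singleton.mpr ?_
  rw [aeval_monomial, Finsupp.prod]
  refine Dvd.dvd.mul_left ?_ _
  refine (pow_dvd_pow (X j) (hP d hd)).trans ?_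
  rw [Finsupp.degree_apply d, ← Finset.prod_pow_eq_pow_sum]
  exact Finset.prod_dvd_prod_of_dvd _ _ fun i _ => pow_dvd_pow_of_dvd (hΘ i) _

/-- `translate` on a variable. [folklore] -/
theorem translate_X {σ : Type*} (b : σ → K) (i : σ) : PointBlowup.translate b (X i : MvPolynomial σ K) = X i + C (b i) := by
  unfold PointBlowup.translate; rw [aeval_X]

/-- Powers of an `f`-free polynomial are `f`-free. [folklore] -/
theorem varFree_pow {σ : Type*} {f : σ} {P : MvPolynomial σ K} (hP : ∀ μ ∈ P.support, μ f = 0) (n : ℕ) :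
    ∀ μ ∈ (P ^ n).support, μ f = 0 := by
  classical
  induction n with
  | zero => rw [pow_zero, ← C_1]; exact WallFrames.varFree_C f 1
  | succ n ih => rw [pow_succ]; exact WallFrames.varFree_mul ih hP

/-- Over `Fin 3 = {f, k, l}`: `∏ᵢ g i = g f · g k · g l`. [folklore] -/
theorem prod_three {M : Type*} [CommMonoid M] {f k l : Fin 3} (hfk : f ≠ k) (hfl : f ≠ l) (hkl : k ≠ l) (g : Fin 3 → M) :
    ∏ i, g i = g f * g k * g l := by
  have huniv : (Finset.univ : Finset (Fin 3)) = {f, k, l} := by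
    ext i; simp only [Finset.mem_univ, Finset.mem_insert, Finset.mem_singleton, true_iff]; exact fin3_exhaust hfk hfl hkl i
  rw [huniv, Finset.prod_insert (by simp [hfk, hfl]), Finset.prod_insert (by simp [hkl]), Finset.prod_singleton, mul_assoc]

/-- The exponent map `D` of the free chart: `d ↦ (f : |d|, k : d_k, l : d_f)`. [new] -/
noncomputable def dmap (f k l : Fin 3) (d : Fin 3 →₀ ℕ) : Fin 3 →₀ ℕ :=
  Finsupp.single f d.degree + Finsupp.single k (d k) + Finsupp.single l (d f)

/-- The free-chart exponent map `dmap`: the new free letter receives the total degree `|d|`. [new] -/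
theorem dmap_apply_f {f k l : Fin 3} (hfk : f ≠ k) (hfl : f ≠ l) (d : Fin 3 →₀ ℕ) : dmap f k l d f = d.degree := by
  simp [dmap, hfk, hfl]

/-- The free-chart exponent map `dmap`: the kept wall keeps its exponent `d_k`. [new] -/
theorem dmap_apply_k {f k l : Fin 3} (hfk : f ≠ k) (hkl : k ≠ l) (d : Fin 3 →₀ ℕ) : dmap f k l d k = d k := by
  simp [dmap, hfk.symm, hkl]

/-- The free-chart exponent map `dmap`: the new wall letter receives the old free exponent `d_f`. [new] -/
theorem dmap_apply_l {f k l : Fin 3} (hfl : f ≠ l) (hkl : k ≠ l) (d : Fin 3 →₀ ℕ) : dmap f k l d l = d f := by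
  simp [dmap, hfl.symm, hkl.symm]

/-- The free-chart exponent map `dmap` is injective (the old exponent is recovered from `(|d|, d_k, d_f)`). [new] -/
theorem dmap_injective {f k l : Fin 3} (hfk : f ≠ k) (hfl : f ≠ l) (hkl : k ≠ l) {d d' : Fin 3 →₀ ℕ}
    (h : dmap f k l d = dmap f k l d') : d = d' := by
  have hf : d f = d' f := by simpa [dmap_apply_l hfl hkl] using DFunLike.congr_fun h l
  have hk : d k = d' k := by simpa [dmap_apply_k hfk hkl] using DFunLike.congr_fun h k
  have hdeg : d.degree = d'.degree := by simpa [dmap_apply_f hfk hfl] using DFunLike.congr_fun h f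
  rw [degree_eq_three hfk hfl hkl (fin3_exhaust hfk hfl hkl), degree_eq_three hfk hfl hkl (fin3_exhaust hfk hfl hkl)] at hdeg
  ext i
  rcases fin3_exhaust hfk hfl hkl i with rfl | rfl | rfl
  · exact hf
  · exact hk
  · omega

/-- The monomial with exponent `dmap d` is `y_f^{|d|} y_k^{d_k} y_l^{d_f}` (with its coefficient). [new] -/
theorem monomial_dmap {f k l : Fin 3} (d : Fin 3 →₀ ℕ) (r : K) :
    monomial (dmap f k l d) r = C r * (X f ^ d.degree * X k ^ d k * X l ^ d f) := by
  rw [dmap, X_pow_eq_monomial, X_pow_eq_monomial, X_pow_eq_monomial, monomial_mul, monomial_mul, C_mul_monomial]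
  simp

/-- **FREE-CHART LAW (L3b).**  Frame `G = σ_η(H)`, `η = a_k y_k + a_l y_l`; the move blows up the origin, takes the chart
of the FREE variable `y_f` and translates by `b = β e_l`.  If the new stage is near then
(i) NEARNESS `1 + a_l β = 0` (so `a_l ≠ 0 ≠ β`: the centre is the trace of the tangent plane on the new wall), and
(ii) the Θ-IDENTITY `y_f^s · σ_{−(a_k/a_l) y_k}^{(l)}(G') = H(y_f y_k, y_f U, a_l y_f y_l)` with
`U = y_l + β − (a_k/a_l) y_k` — the new frame polynomial (free variable now `y_l`) is read off monomial by monomial.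
[cite: CossartJannsenSaito2020, Lemma 12.1 p.132; Kollar2007, 2.59.1] -/
theorem free_step {f k l : Fin 3} (hfk : f ≠ k) (hfl : f ≠ l) (hkl : k ≠ l) {s : ℕ} (hs : s ≠ 0)
    {H : MvPolynomial (Fin 3) K} {c ak al : K} (hc : c ≠ 0) (hin : homogeneousComponent s H = C c * X f ^ s)
    (hord : ordZero H = s) {b : Fin 3 → K} (hb : ∀ i, i ≠ l → b i = 0)
    (hnear : (1 : ℕ∞) ≤ ordZero (PointBlowup.translate b (chartTransform s f (WallFrames.zshear f (C ak * X k + C al * X l) H)))) :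
    1 + al * b l = 0 ∧
      X f ^ s * WallFrames.zshear l (-(C (ak / al) * X k))
          (PointBlowup.translate b (chartTransform s f (WallFrames.zshear f (C ak * X k + C al * X l) H))) =
        aeval (fun i => if i = k then X f * X k else if i = l then X f * (X l + C (b l) - C (ak / al) * X k)
          else X f * (C al * X l)) H := by
  classical
  set G := WallFrames.zshear f (C ak * X k + C al * X l) H with hG
  set G' := PointBlowup.translate b (chartTransform s f G) with hG'
  have hηf := varFree_lin (K := K) (Ne.symm hfk) (Ne.symm hfl) ak al
  have hordG : (s : ℕ∞) ≤ ordZero G := by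
    rw [hG, WallFrames.ordZero_zshear hηf (one_le_ordZero_lin k l ak al), hord]
  -- the general Θ (before nearness)
  set A : MvPolynomial (Fin 3) K := C (1 + al * b l) + C al * X l + C (ak - al * (ak / al)) * X k with hA
  set Θ : Fin 3 → MvPolynomial (Fin 3) K := fun i =>
    if i = k then X f * X k else if i = l then X f * (X l + C (b l) - C (ak / al) * X k) else X f * A with hΘ
  have hΘk : Θ k = X f * X k := by simp [hΘ]
  have hΘl : Θ l = X f * (X l + C (b l) - C (ak / al) * X k) := by simp [hΘ, hkl.symm]
  have hΘf : Θ f = X f * A := by simp [hΘ, hfk, hfl]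
  -- (ii') the Θ-identity with the general `A`
  have hid : X f ^ s * WallFrames.zshear l (-(C (ak / al) * X k)) G' = aeval Θ H := by
    have h1 : X f ^ s * WallFrames.zshear l (-(C (ak / al) * X k)) G' =
        WallFrames.zshear l (-(C (ak / al) * X k)) (PointBlowup.translate b (X f ^ s * chartTransform s f G)) := by
      rw [hG']
      unfold PointBlowup.translate
      rw [map_mul, map_pow, aeval_X, hb f hfl, C_0, add_zero, map_mul, map_pow, WallFrames.zshear_X_of_ne hfl]
    rw [h1, PointBlowup.X_pow_mul_chartTransform f hordG, hG]
    unfold PointBlowup.translate WallFrames.zshear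
    rw [← AlgHom.comp_apply, ← AlgHom.comp_apply, ← AlgHom.comp_apply]
    congr 1
    refine MvPolynomial.algHom_ext fun i => ?_
    simp only [AlgHom.comp_apply, aeval_X]
    rcases fin3_exhaust hfk hfl hkl i with rfl | rfl | rfl
    · simp only [if_true, map_add, map_mul, aeval_C, aeval_X, if_neg (Ne.symm hfk), if_neg (Ne.symm hfl), hb _ hfl,
        hb k hkl, C_0, add_zero, if_neg hfl, if_neg hkl, if_true, hΘf, hA, algebraMap_eq, map_add, map_sub, map_mul, map_one]
      ring
    · simp only [aeval_X, if_neg (Ne.symm hfk), map_mul, hb _ hkl, hb _ hfl, C_0, add_zero, if_neg hkl, if_neg hfl, hΘk]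
    · simp only [aeval_X, if_neg (Ne.symm hfl), map_mul, map_add, aeval_C, if_true, hb _ hfl, C_0,
        add_zero, if_neg hfl, hΘl, algebraMap_eq]
      ring
  -- (i) nearness
  have hHf : ∀ i, (X f : MvPolynomial (Fin 3) K) ∣ Θ i := by
    intro i
    rcases fin3_exhaust hfk hfl hkl i with rfl | rfl | rfl
    · rw [hΘf]; exact dvd_mul_right _ _
    · rw [hΘk]; exact dvd_mul_right _ _
    · rw [hΘl]; exact dvd_mul_right _ _
  have htail : aeval Θ (H - homogeneousComponent s H) ∈ Ideal.span {(X f ^ (s + 1) : MvPolynomial (Fin 3) K)} :=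
    aeval_mem_span_pow hHf fun d hd => le_degree_of_mem_support_sub hord.symm.le hd
  have hsplit : aeval Θ H = C c * X f ^ s * A ^ s + aeval Θ (H - homogeneousComponent s H) := by
    conv_lhs => rw [← sub_add_cancel H (homogeneousComponent s H), add_comm]
    rw [map_add, hin, map_mul, map_pow, aeval_C, aeval_X, hΘf, algebraMap_eq, mul_pow, mul_assoc, add_comm]
  have hκ : 1 + al * b l = 0 := by
    have hmem : X f ^ s * (WallFrames.zshear l (-(C (ak / al) * X k)) G' - C c * A ^ s) ∈
        Ideal.span {(X f ^ (s + 1) : MvPolynomial (Fin 3) K)} := by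
      rw [mul_sub, hid, hsplit]; convert htail using 1; ring
    have h1 := constantCoeff_eq_of_sub_mem_span_X (mem_span_X_of_pow_mul_mem hmem)
    have h0 : constantCoeff (WallFrames.zshear l (-(C (ak / al) * X k)) G') = 0 := by
      unfold WallFrames.zshear
      rw [WallFrames.constantCoeff_aeval_of_forall]
      · exact (one_le_ordZero_iff G').mp hnear
      · intro i
        split_ifs with h
        · rw [map_add, constantCoeff_X, map_neg, map_mul, constantCoeff_C, constantCoeff_X, mul_zero, neg_zero, add_zero]
        · exact constantCoeff_X (R := K) i
    rw [h0, map_mul, constantCoeff_C, map_pow] at h1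
    have hA0 : constantCoeff A = 1 + al * b l := by
      rw [hA, map_add, map_add, constantCoeff_C, map_mul, constantCoeff_C, constantCoeff_X, map_mul, constantCoeff_C,
        constantCoeff_X, mul_zero, mul_zero, add_zero, add_zero]
    rw [hA0] at h1
    rcases mul_eq_zero.mp h1.symm with h | h
    · exact absurd h hc
    · exact (pow_eq_zero_iff hs).mp h
  refine ⟨hκ, ?_⟩
  -- (ii) with nearness, `A = a_l y_l`
  have hal : al ≠ 0 := by rintro rfl; simp at hκ
  have hA' : A = C al * X l := by
    rw [hA, hκ, C_0, zero_add, mul_div_cancel₀ _ hal, sub_self, C_0, zero_mul, add_zero]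
  have hΘ' : Θ = fun i => if i = k then X f * X k else if i = l then X f * (X l + C (b l) - C (ak / al) * X k)
      else X f * (C al * X l) := by
    funext i
    rcases fin3_exhaust hfk hfl hkl i with rfl | rfl | rfl
    · rw [hΘf, hA', if_neg hfk, if_neg hfl]
    · rw [hΘk, if_pos rfl]
    · rw [hΘl, if_neg hkl.symm, if_pos rfl]
  rw [hid, hΘ']

end FreeChart

end Summit.ResolutionOfSingularities.ResolutionOfSingularities.Theorems.WildDescent
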